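import Summits.ValiantsHypothesis.ValiantsHypothesis.Theorems.DefinabilityGapRegularSkeleton
import HarnessLib

/-!
# DefinabilityGap — the translated axis: `G_m` hits EVERY width-2 read-once chain with nonsingular links (`m ≥ 3`)

Route `route-ValiantsHypothesis-DefinabilityGap` (decomp-valiant cycle 1, lens 5), read-once leaf F4 / W10
(`KIPlantedHittingRO`, stmt-ValiantsHypothesis-23704), width road; `P_c = kiPer m c`, `φ = bind₁ (kiPer m)`.
LABELS: helper on the width road of leaf 23704 · 0 S-currency · closes NO item · NOT a rung or leaf above RatioLeaf ·
KIPlantedHitting / DcPerSuperpolynomial / VP ≠ VNP untouched · decides the NONSINGULAR half of the `RatioLeaf(m)` class.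

THE INSTRUMENT (§2, `Θ_{c,t} = transHom m c i₀ t`). For `m ≥ 3`, EVERY block `c` and EVERY base value `t ∈ ℂ` admit a
seed substitution `Θ_{c,t} : ℂ[y] → ℂ[X]` with `Θ_{c,t}(P_c) = X` and `Θ_{c,t}(P_b) = t` for all `b ≠ c`, i.e. `Θ_{c,t} ∘ φ`
restricts to the line `{z_c = X, z_b = t}` through the DIAGONAL point `(t, …, t)` (`axisHom` is `t = 0`): `X - t` at the
diagonal cell `E_c(i₀,i₀)`, `1` at the other diagonal cells of `c`, and — OUTSIDE the block — `t` resp. `1` at ALL seed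
cells on a ROTATED-diagonal abscissa `x_{(i+1, i)}`; a transversal inside diagonal ∪ rotated diagonal is one of the two
(§1: the rotation is an `m`-cycle) and a full diagonal inside the kept cells belongs to `c` (blocks share `≤ 2` cells).
This refutes the informal CEILING (ii) of `DefinabilityGapAxisSubstitution` («base point cannot be moved off `0`»).

CONSEQUENCE (§§3–5). The direction-rigidity induction of `DefinabilityGapRegularSkeleton` runs verbatim at base point `t`
(skeleton `M_{k+1}(t)⋯M_N(t)·v`), and for NONSINGULAR links (`det M_j ≢ 0`) some `t ∈ ℂ` makes every suffix skeleton
nonzero (`det ∏_j M_j(X) ≠ 0`; finitely many suffixes and roots). HENCE `G_m` hits every nonzero width-2 read-once block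
chain with nonsingular links — ANY order, length, degree, crowding, boundary; NO stall hypothesis
(`kiPer_hits_widthTwo_of_det_ne_zero`; `m ≥ 3` is sharp by `DefinabilityGapWidthTwoAtTwo`). Continuant (`det M_j(0) ≠ 0`,
`RegularSkeleton`) and triangular (`AxisSubstitution`) chains were ALREADY decided; NEWLY decided are the nonsingular
chains whose constant skeleton STALLS at `0`, e.g. links `[[z_c + 1, 1], [z_c, z_c]]` (`det = z_c²`) on any crowded block
set. WHAT REMAINS of full width 2 (`RatioLeaf(m)`, `ratioLeaf_iff`): chains with a SINGULAR link (`M_j = a·bᵀ` over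
`ℂ[X]`, rank-one splitting; not typed here). [cite: SahaSaptharishiSaxena2009, Lemma 2.1] [cite: KabanetsImpagliazzo2003, Lemma 30]
-/

noncomputable section
open MvPolynomial
open scoped Polynomial
open Literature.Computability.AlgebraicComplexity Literature.Computability.MetaComplexity
open Summit.ValiantsHypothesis.ValiantsHypothesis.Theorems.DefinabilityGapAffineRung
open Summit.ValiantsHypothesis.ValiantsHypothesis.Theorems.DefinabilityGapZeroedBlocks
open Summit.ValiantsHypothesis.ValiantsHypothesis.Theorems.DefinabilityGapAxisSubstitution
open Summit.ValiantsHypothesis.ValiantsHypothesis.Theorems.DefinabilityGapZperTransfer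
open Summit.ValiantsHypothesis.ValiantsHypothesis.Theorems.DefinabilityGapRatioLeaf
open Summit.ValiantsHypothesis.ValiantsHypothesis.Theorems.DefinabilityGapRegularSkeleton
open Summit.ValiantsHypothesis.ValiantsHypothesis.Theorems.DefinabilityGapPivotCertificate
set_option linter.dupNamespace false
namespace Summit.ValiantsHypothesis.ValiantsHypothesis.Theorems.DefinabilityGapTranslatedSkeleton
variable {m : ℕ}
/-! ## 1. Transversals inside two patterns: the diagonal and the rotated diagonal -/
/-- A permutation moving every point to itself or to its successor is the identity or the rotation. [folklore] -/
theorem perm_eq_one_or_eq_finRotate (hm : 2 ≤ m) (ρ : Equiv.Perm (Fin m))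
    (h : ∀ i, ρ i = i ∨ ρ i = finRotate m i) : ρ = 1 ∨ ρ = finRotate m := by
  have hfix : ∀ i : Fin m, finRotate m i ≠ i := fun i =>
    Equiv.Perm.mem_support.1 (by rw [support_finRotate_of_le hm]; exact Finset.mem_univ i)
  by_cases hex : ∃ i₀, ρ i₀ = finRotate m i₀
  · obtain ⟨i₀, h0⟩ := hex
    have key : ∀ k : ℕ, ρ ((finRotate m ^ k) i₀) = (finRotate m ^ (k + 1)) i₀ := by
      intro k
      induction k with
      | zero => simpa using h0
      | succ k ih =>
        rw [pow_succ' _ k, Equiv.Perm.mul_apply] at ih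
        rw [pow_succ' _ (k + 1), Equiv.Perm.mul_apply, pow_succ' _ k, Equiv.Perm.mul_apply]
        rcases h (finRotate m ((finRotate m ^ k) i₀)) with h1 | h1
        · exact absurd (ρ.injective (h1.trans ih.symm)) (hfix _)
        · exact h1
    refine Or.inr (Equiv.ext fun i => ?_)
    obtain ⟨k, rfl⟩ :=
      (isCycle_finRotate_of_le hm).exists_pow_eq (hfix i₀) (hfix i)
    rw [key k, pow_succ' _ k, Equiv.Perm.mul_apply]
  · exact Or.inl (Equiv.ext fun i => by simpa using (h i).resolve_right fun hi => hex ⟨i, hi⟩)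

/-- Contrapositive form: any other transversal leaves both patterns at some column. [folklore] -/
theorem exists_off_patterns (hm : 2 ≤ m) {ρ : Equiv.Perm (Fin m)} (h1 : ρ ≠ 1) (h2 : ρ ≠ finRotate m) :
    ∃ i, ρ i ≠ i ∧ ρ i ≠ finRotate m i := by
  by_contra! h
  exact (perm_eq_one_or_eq_finRotate hm ρ fun i => (em (ρ i = i)).imp_right (h i)).elim h1 h2

/-! ## 2. The translated axis substitution `Θ_{c,t}` -/
/-- Cells at equal abscissa sit at equal positions, whatever the blocks (`DefinabilityGapPivotCertificate.cellEmb_fst`). [this file] -/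
theorem cellEmb_fst_eq_iff {c c' : Fin 3 → Fin (qOf m)} {p p' : Fin m × Fin m} :
    (cellEmb m c p).1 = (cellEmb m c' p').1 ↔ p = p' := by
  rw [cellEmb_fst, cellEmb_fst]
  exact (permPad (sq_le_qOf m)).injective.eq_iff

/-- The abscissa of the rotated-diagonal position `(i+1, i)` (in every block). [this file] -/
def rotCol (m : ℕ) (i : Fin m) : Fin (qOf m) := permPad (sq_le_qOf m) (finRotate m i, i)

/-- The translated axis substitution of block `c` through the diagonal cell `i₀` with base value `t`: `X - t` at
`E_c(i₀,i₀)`, `1` on the other diagonal cells of `c`, `t` on the rotated-diagonal column `i₀`, `1` on the other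
rotated-diagonal columns, `0` elsewhere. [this file] -/
def transFun (m : ℕ) (c : Fin 3 → Fin (qOf m)) (i₀ : Fin m) (t : ℂ) (x : Fin (qOf m) × Fin (qOf m)) : ℂ[X] :=
  if x = cellEmb m c (i₀, i₀) then Polynomial.X - Polynomial.C t
  else if x ∈ diagCells m c then 1
  else if x.1 = rotCol m i₀ then Polynomial.C t
  else if x.1 ∈ Finset.univ.image (rotCol m) then 1 else 0

/-- `Θ_{c,t} : ℂ[y] →ₐ[ℂ] ℂ[X]`. [this file] -/
def transHom (m : ℕ) (c : Fin 3 → Fin (qOf m)) (i₀ : Fin m) (t : ℂ) :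
    MvPolynomial (Fin (qOf m) × Fin (qOf m)) ℂ →ₐ[ℂ] ℂ[X] :=
  aeval (transFun m c i₀ t)

/-- `Θ_{c,t}` at an OFF-diagonal position `(r, i)` of ANY block: `t` / `1` on the rotated diagonal (column `i₀` / the
others), `0` off it. [this file] -/
theorem transFun_offDiag (c b : Fin 3 → Fin (qOf m)) (i₀ : Fin m) (t : ℂ) {r i : Fin m} (hri : r ≠ i) :
    transFun m c i₀ t (cellEmb m b (r, i)) =
      if r = finRotate m i then (if i = i₀ then Polynomial.C t else 1) else 0 := by
  have hne : cellEmb m b (r, i) ≠ cellEmb m c (i₀, i₀) := fun e =>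
    have h := Prod.ext_iff.1 (cellEmb_fst_eq_iff.1 (congrArg Prod.fst e)); hri (h.1.trans h.2.symm)
  have hnd : cellEmb m b (r, i) ∉ diagCells m c := fun hmem => by
    obtain ⟨j, hj⟩ := mem_diagCells.1 hmem
    have h := Prod.ext_iff.1 (cellEmb_fst_eq_iff.1 (congrArg Prod.fst hj))
    exact hri (h.1.symm.trans h.2)
  have hcol : ∀ j, (cellEmb m b (r, i)).1 = rotCol m j ↔ r = finRotate m i ∧ i = j := fun j => by
    rw [rotCol, cellEmb_fst, (permPad (sq_le_qOf m)).injective.eq_iff, Prod.mk.injEq]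
    exact ⟨fun h => ⟨h.1.trans (by rw [h.2]), h.2⟩, fun h => ⟨h.1.trans (by rw [h.2]), h.2⟩⟩
  by_cases hr : r = finRotate m i
  · subst hr
    have hmem : (cellEmb m b (finRotate m i, i)).1 ∈ Finset.univ.image (rotCol m) :=
      Finset.mem_image.2 ⟨i, Finset.mem_univ _, ((hcol i).2 ⟨rfl, rfl⟩).symm⟩
    rw [if_pos rfl, transFun, if_neg hne, if_neg hnd]
    by_cases hi : i = i₀
    · rw [if_pos ((hcol i₀).2 ⟨rfl, hi⟩), if_pos hi]
    · rw [if_neg fun h => hi ((hcol i₀).1 h).2, if_pos hmem, if_neg hi]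
  · have hmem : (cellEmb m b (r, i)).1 ∉ Finset.univ.image (rotCol m) := fun hmem => by
      obtain ⟨j, -, hj⟩ := Finset.mem_image.1 hmem
      exact hr ((hcol j).1 hj.symm).1
    rw [if_neg hr, transFun, if_neg hne, if_neg hnd, if_neg fun h => hr ((hcol i₀).1 h).1, if_neg hmem]

/-- Under `Θ_{c,t}` the permanent of ANY block `b` is (its diagonal term) `+ t`. [this file] -/
theorem transHom_kiPer (hm : 3 ≤ m) (c b : Fin 3 → Fin (qOf m)) (i₀ : Fin m) (t : ℂ) :
    transHom m c i₀ t (kiPer m b) = (∏ i, transFun m c i₀ t (cellEmb m b (i, i))) + Polynomial.C t := by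
  classical
  have hfix : ∀ i : Fin m, finRotate m i ≠ i := fun i =>
    Equiv.Perm.mem_support.1 (by rw [support_finRotate_of_le (by omega : 2 ≤ m)]; exact Finset.mem_univ i)
  have hrot : (1 : Equiv.Perm (Fin m)) ≠ finRotate m := fun e => hfix i₀ (by simp [← e])
  rw [transHom, aeval_kiPer, Finset.sum_eq_add_of_mem (1 : Equiv.Perm (Fin m)) (finRotate m) (Finset.mem_univ _)
    (Finset.mem_univ _) hrot]
  · simp only [Equiv.Perm.coe_one, id_eq]
    rw [Finset.prod_congr rfl fun i _ => (transFun_offDiag c b i₀ t (hfix i)).trans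
      (if_pos rfl), Finset.prod_ite_eq', if_pos (Finset.mem_univ _)]
  · intro ρ _ hρ
    obtain ⟨i, h1, h2⟩ := exists_off_patterns (by omega) hρ.1 hρ.2
    exact Finset.prod_eq_zero (Finset.mem_univ i) (by rw [transFun_offDiag c b i₀ t h1, if_neg h2])

/-- **(T1)** `Θ_{c,t}(P_c) = X`: the diagonal of `c` gives `X - t`. [this file] -/
theorem transHom_kiPer_self (hm : 3 ≤ m) (c : Fin 3 → Fin (qOf m)) (i₀ : Fin m) (t : ℂ) :
    transHom m c i₀ t (kiPer m c) = Polynomial.X := by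
  classical
  rw [transHom_kiPer hm, ← Finset.mul_prod_erase Finset.univ _ (Finset.mem_univ i₀), Finset.prod_eq_one, mul_one]
  · rw [transFun, if_pos rfl, sub_add_cancel]
  · intro i hi
    have hne : cellEmb m c (i, i) ≠ cellEmb m c (i₀, i₀) := fun e =>
      Finset.ne_of_mem_erase hi (Prod.ext_iff.1 ((cellEmb m c).injective e)).1
    rw [transFun, if_neg hne, if_pos (mem_diagCells.2 ⟨i, rfl⟩)]

/-- **(T2)** `Θ_{c,t}(P_b) = t` for `b ≠ c` (`m ≥ 3`): the diagonal of `b` leaves the diagonal cells of `c` somewhere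
(two blocks share `≤ 2 < m` cells), and a diagonal cell outside them is killed. [this file] -/
theorem transHom_kiPer_ne (hm : 3 ≤ m) {c b : Fin 3 → Fin (qOf m)} (hb : b ≠ c) (i₀ : Fin m) (t : ℂ) :
    transHom m c i₀ t (kiPer m b) = Polynomial.C t := by
  classical
  rw [transHom_kiPer hm, add_eq_right]
  obtain ⟨i, hi⟩ : ∃ i, cellEmb m b (i, i) ∉ diagCells m c := by
    by_contra! hall
    have hsub : (Finset.univ.image fun i : Fin m => cellEmb m b (i, i)) ⊆ cells m c ∩ cells m b := by
      intro x hx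
      obtain ⟨i, -, rfl⟩ := Finset.mem_image.1 hx
      exact Finset.mem_inter.2 ⟨diagCells_subset_cells c (hall i), Finset.mem_map.2 ⟨(i, i), Finset.mem_univ _, rfl⟩⟩
    have hcard : (Finset.univ.image fun i : Fin m => cellEmb m b (i, i)).card = m := by
      rw [Finset.card_image_of_injective _ fun i j hij => (Prod.ext_iff.1 ((cellEmb m b).injective hij)).1,
        Finset.card_univ, Fintype.card_fin]
    have h2 := (Finset.card_le_card hsub).trans (card_cells_inter_le hb.symm)
    omega
  have hne : cellEmb m b (i, i) ≠ cellEmb m c (i₀, i₀) := fun e => hi (e ▸ mem_diagCells.2 ⟨i₀, rfl⟩)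
  have hcol : ∀ j, (cellEmb m b (i, i)).1 ≠ rotCol m j := fun j e => by
    have h := Prod.ext_iff.1 ((permPad (sq_le_qOf m)).injective ((cellEmb_fst m b (i, i)).symm.trans e))
    exact absurd (h.1.symm.trans h.2)
      (Equiv.Perm.mem_support.1 (by rw [support_finRotate_of_le (by omega : 2 ≤ m)]; exact Finset.mem_univ j))
  have hmem : (cellEmb m b (i, i)).1 ∉ Finset.univ.image (rotCol m) := fun hmem => by
    obtain ⟨j, -, hj⟩ := Finset.mem_image.1 hmem
    exact hcol j hj.symm
  exact Finset.prod_eq_zero (Finset.mem_univ i) (by rw [transFun, if_neg hne, if_neg hi, if_neg (hcol i₀), if_neg hmem])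

/-- `Θ_{c,t}(p(P_c)) = p`. [this file] -/
theorem transHom_aeval_kiPer (hm : 3 ≤ m) (c : Fin 3 → Fin (qOf m)) (i₀ : Fin m) (t : ℂ) (p : ℂ[X]) :
    transHom m c i₀ t (Polynomial.aeval (kiPer m c) p) = p := by
  rw [← Polynomial.aeval_algHom_apply, transHom_kiPer_self hm, Polynomial.aeval_X_left_apply]

/-- **(T3)** `Θ_{c,t}(φ E) = E(t, …, t)` for `E` not reading `z_c` (`m ≥ 3`). [this file] -/
theorem transHom_bind₁_of_not_mem_vars (hm : 3 ≤ m) (c : Fin 3 → Fin (qOf m)) (i₀ : Fin m) (t : ℂ)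
    {E : MvPolynomial (Fin 3 → Fin (qOf m)) ℂ} (hE : c ∉ E.vars) :
    transHom m c i₀ t (bind₁ (kiPer m) E) = Polynomial.C (eval (fun _ => t) E) := by
  have hC : ∀ F : MvPolynomial (Fin 3 → Fin (qOf m)) ℂ,
      aeval (fun _ : Fin 3 → Fin (qOf m) => Polynomial.C t) F = Polynomial.C (eval (fun _ => t) F) := fun F =>
    RingHom.congr_fun (MvPolynomial.ringHom_ext (f := (aeval fun _ : Fin 3 → Fin (qOf m) => Polynomial.C t).toRingHom)
      (g := Polynomial.C.comp (eval fun _ => t)) (fun r => by simp [Polynomial.algebraMap_eq]) (fun b => by simp)) F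
  rw [← AlgHom.comp_apply, ← aeval_eq_bind₁, comp_aeval, ← hC]
  refine hom_congr_vars (f₁ := (aeval fun b => transHom m c i₀ t (kiPer m b)).toRingHom)
    (f₂ := (aeval fun _ : Fin 3 → Fin (qOf m) => Polynomial.C t).toRingHom) (RingHom.ext fun r => by simp)
    (fun b hb _ => ?_) rfl
  have hbc : b ≠ c := by rintro rfl; exact hE hb
  simp [transHom_kiPer_ne hm hbc]

/-! ## 3. The skeleton at base point `t`: `M_1(t) ⋯ M_N(t) · v` -/
/-- The univariate skeleton column `M_1(X)⋯M_N(X)·v ∈ ℂ[X]²`. [this file] -/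
def skelPoly (l : List (W2Link m)) (v : Fin 2 → ℂ) : Fin 2 → ℂ[X] :=
  ((l.map W2Link.M).prod).mulVec fun k => Polynomial.C (v k)

/-- The skeleton vector at base point `t`: `M_1(t)⋯M_N(t)·v`. [this file] -/
def skelAt (t : ℂ) (l : List (W2Link m)) (v : Fin 2 → ℂ) (k : Fin 2) : ℂ := (skelPoly l v k).eval t

/-- The empty skeleton vector is `v`. [this file] -/
theorem skelAt_nil (t : ℂ) (v : Fin 2 → ℂ) (k : Fin 2) : skelAt t ([] : List (W2Link m)) v k = v k := by simp [skelAt, skelPoly]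

/-- Peeling the head link of the skeleton vector. [this file] -/
theorem skelAt_cons (t : ℂ) (L : W2Link m) (rest : List (W2Link m)) (v : Fin 2 → ℂ) (k : Fin 2) :
    skelAt t (L :: rest) v k = (L.M k 0).eval t * skelAt t rest v 0 + (L.M k 1).eval t * skelAt t rest v 1 := by
  have hc : skelPoly (L :: rest) v k = L.M k 0 * skelPoly rest v 0 + L.M k 1 * skelPoly rest v 1 := by
    rw [skelPoly, skelPoly, List.map_cons, List.prod_cons, ← Matrix.mulVec_mulVec]
    simp [Matrix.mulVec, dotProduct, Fin.sum_univ_two]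
  rw [skelAt, hc, Polynomial.eval_add, Polynomial.eval_mul, Polynomial.eval_mul]
  rfl

/-- **The value of a column at the diagonal point `(t, …, t)` is the skeleton vector at `t`.** [this file] -/
theorem eval_col (t : ℂ) (l : List (W2Link m)) (v : Fin 2 → ℂ) (k : Fin 2) :
    eval (fun _ => t) (col l v k) = skelAt t l v k := by
  have euni : ∀ (c : Fin 3 → Fin (qOf m)) (u : ℂ[X]), eval (fun _ : Fin 3 → Fin (qOf m) => t) (uni c u) = u.eval t :=
    fun c u => by
    show (aeval fun _ : Fin 3 → Fin (qOf m) => t) (Polynomial.aeval (X c) u) = _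
    rw [← Polynomial.aeval_algHom_apply, aeval_X, Polynomial.coe_aeval_eq_eval]
  induction l generalizing k with
  | nil => rw [col_nil, eval_C, skelAt_nil]
  | cons L rest ih => rw [col_cons, map_add, map_mul, map_mul, euni, euni, ih, ih, skelAt_cons]

/-- **`Θ_{c,t}(φ G'_k) =` the skeleton vector at `t`** for a suffix not reading `z_c` (`m ≥ 3`). [this file] -/
theorem transHom_bind₁_col (hm : 3 ≤ m) {c : Fin 3 → Fin (qOf m)} {rest : List (W2Link m)}
    (hc : c ∉ rest.map W2Link.blk) (i₀ : Fin m) (t : ℂ) (v : Fin 2 → ℂ) (k : Fin 2) :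
    transHom m c i₀ t (bind₁ (kiPer m) (col rest v k)) = Polynomial.C (skelAt t rest v k) := by
  rw [transHom_bind₁_of_not_mem_vars hm c i₀ t (not_mem_vars_col hc v k), eval_col]

/-- **Nonsingular links admit a good base point**: some `t ∈ ℂ` makes EVERY suffix skeleton vector at `t` nonzero
(`∏_j M_j(X)` has nonzero determinant, hence trivial kernel; finitely many suffixes, finitely many roots). [this file] -/
theorem exists_skelAt_ne_zero (l : List (W2Link m)) (hdet : ∀ L ∈ l, L.M.det ≠ 0) {v : Fin 2 → ℂ} (hv : v ≠ 0) :
    ∃ t : ℂ, ∀ s : List (W2Link m), s <:+ l → skelAt t s v ≠ 0 := by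
  classical
  have hd : ∀ s : List (W2Link m), (∀ L ∈ s, L.M.det ≠ 0) → ((s.map W2Link.M).prod).det ≠ 0 := by
    intro s
    induction s with
    | nil => intro; simp
    | cons L r ih =>
      intro h
      rw [List.map_cons, List.prod_cons, Matrix.det_mul]
      exact mul_ne_zero (h L List.mem_cons_self) (ih fun L' hL' => h L' (List.mem_cons_of_mem _ hL'))
  have hne : ∀ s : List (W2Link m), s <:+ l → ∃ k, skelPoly s v k ≠ 0 := fun s hs => by
    by_contra! h
    have h0 : ((s.map W2Link.M).prod).mulVec (fun k => Polynomial.C (v k)) = 0 := funext h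
    have h1 : (fun k => Polynomial.C (v k)) = (0 : Fin 2 → ℂ[X]) :=
      Matrix.eq_zero_of_mulVec_eq_zero (hd s fun L hL => hdet L (hs.subset hL)) h0
    exact hv (funext fun k => by simpa using congrFun h1 k)
  obtain ⟨t, ht⟩ := Infinite.exists_notMem_finset
    (l.tails.toFinset.biUnion fun s => Finset.univ.biUnion fun k => (skelPoly s v k).roots.toFinset)
  refine ⟨t, fun s hs hzero => ht (Finset.mem_biUnion.2 ⟨s, List.mem_toFinset.2 ((List.mem_tails s l).2 hs), ?_⟩)⟩
  obtain ⟨k, hk⟩ := hne s hs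
  refine Finset.mem_biUnion.2 ⟨k, Finset.mem_univ _, ?_⟩
  rw [Multiset.mem_toFinset, Polynomial.mem_roots hk]
  exact congrFun hzero k

/-! ## 4. Direction rigidity at base point `t` -/
/-- **THE STEP at base point `t`.** `M(P_c)·Φ = x·w` with `det M ≠ 0`, `Θ_{c,t}(Φ) = g ≠ 0` constant: then
(a) `Φ = x'·g` for a polynomial `x'`, and (b) `M(X)·g = Θ_{c,t}(x)·w` in `ℂ[X]²`. [this file] -/
theorem step (hm : 3 ≤ m) (c : Fin 3 → Fin (qOf m)) (i₀ : Fin m) (t : ℂ) (M : Matrix (Fin 2) (Fin 2) ℂ[X])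
    (hM : M.det ≠ 0) (w g : Fin 2 → ℂ) (hg : g ≠ 0) (x : MvPolynomial (Fin (qOf m) × Fin (qOf m)) ℂ)
    (Φ : Fin 2 → MvPolynomial (Fin (qOf m) × Fin (qOf m)) ℂ) (hψ : ∀ j, transHom m c i₀ t (Φ j) = Polynomial.C (g j))
    (H : ∀ k, Polynomial.aeval (kiPer m c) (M k 0) * Φ 0 + Polynomial.aeval (kiPer m c) (M k 1) * Φ 1 = x * C (w k)) :
    (∃ x' : MvPolynomial (Fin (qOf m) × Fin (qOf m)) ℂ, ∀ j, Φ j = x' * C (g j)) ∧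
      ∀ k, M k 0 * Polynomial.C (g 0) + M k 1 * Polynomial.C (g 1) = transHom m c i₀ t x * Polynomial.C (w k) := by
  have hb : ∀ k, M k 0 * Polynomial.C (g 0) + M k 1 * Polynomial.C (g 1) = transHom m c i₀ t x * Polynomial.C (w k) :=
    fun k => by
    have h := congrArg (transHom m c i₀ t) (H k)
    rwa [map_add, map_mul, map_mul, transHom_aeval_kiPer hm, transHom_aeval_kiPer hm, hψ 0, hψ 1, map_mul,
      ← MvPolynomial.algebraMap_eq, AlgHom.commutes, Polynomial.algebraMap_eq] at h
  refine ⟨?_, hb⟩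
  have hPC : ∀ a : ℂ, Polynomial.aeval (kiPer m c) (Polynomial.C a) = C a := fun a => by
    rw [Polynomial.aeval_C, MvPolynomial.algebraMap_eq]
  set a₀₀ := Polynomial.aeval (kiPer m c) (M 0 0)
  set a₀₁ := Polynomial.aeval (kiPer m c) (M 0 1)
  set a₁₀ := Polynomial.aeval (kiPer m c) (M 1 0)
  set a₁₁ := Polynomial.aeval (kiPer m c) (M 1 1)
  set ξ := Polynomial.aeval (kiPer m c) (transHom m c i₀ t x)
  have hb' : ∀ k, Polynomial.aeval (kiPer m c) (M k 0) * C (g 0) + Polynomial.aeval (kiPer m c) (M k 1) * C (g 1) =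
      ξ * C (w k) := fun k => by
    have h := congrArg (Polynomial.aeval (kiPer m c)) (hb k)
    rwa [map_add, map_mul, map_mul, map_mul, hPC, hPC, hPC] at h
  obtain ⟨e0, e1⟩ := adjugate_two a₀₀ a₀₁ a₁₀ a₁₁ (Φ 0) (Φ 1) x (C (w 0)) (C (w 1)) (H 0) (H 1)
  obtain ⟨f0, f1⟩ := adjugate_two a₀₀ a₀₁ a₁₀ a₁₁ (C (g 0)) (C (g 1)) ξ (C (w 0)) (C (w 1)) (hb' 0) (hb' 1)
  have hδ : a₀₀ * a₁₁ - a₀₁ * a₁₀ ≠ 0 := by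
    have h : a₀₀ * a₁₁ - a₀₁ * a₁₀ = Polynomial.aeval (kiPer m c) M.det := by
      rw [Matrix.det_fin_two, map_sub, map_mul, map_mul]
    rw [h]
    exact aeval_kiPer_ne_zero (by omega) c hM
  have hcross : Φ 0 * C (g 1) = Φ 1 * C (g 0) := by
    refine mul_left_cancel₀ (pow_ne_zero 2 hδ) ?_
    linear_combination ((a₀₀ * a₁₁ - a₀₁ * a₁₀) * C (g 1)) * e0 + (x * (a₁₁ * C (w 0) - a₀₁ * C (w 1))) * f1 -
      ((a₀₀ * a₁₁ - a₀₁ * a₁₀) * C (g 0)) * e1 - (x * (a₀₀ * C (w 1) - a₁₀ * C (w 0))) * f0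
  exact exists_scalar_of_cross Φ g hg hcross

/-- **DIRECTION RIGIDITY at base point `t`** (`m ≥ 3`): nonsingular links, no vanishing proper-suffix skeleton vector
at `t`, and a `φ`-image column of constant direction `w ≠ 0` force the column itself to have direction `w`. [this file] -/
theorem col_parallel (hm : 3 ≤ m) (t : ℂ) : ∀ (l : List (W2Link m)) (v w : Fin 2 → ℂ)
    (x : MvPolynomial (Fin (qOf m) × Fin (qOf m)) ℂ), (l.map W2Link.blk).Nodup → (∀ L ∈ l, L.M.det ≠ 0) →
    (∀ s : List (W2Link m), s <:+ l → s.length < l.length → skelAt t s v ≠ 0) → w ≠ 0 →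
    (∀ k, bind₁ (kiPer m) (col l v k) = x * C (w k)) →
    ∃ Xp : MvPolynomial (Fin 3 → Fin (qOf m)) ℂ, ∀ k, col l v k = Xp * C (w k) := by
  intro l
  induction l with
  | nil =>
    intro v w x _ _ _ hw hx
    have h0 := hx 0
    have h1 := hx 1
    rw [col_nil, bind₁_C_right] at h0 h1
    have e : (C (v 0 * w 1) : MvPolynomial (Fin (qOf m) × Fin (qOf m)) ℂ) = C (v 1 * w 0) := by
      rw [C_mul, C_mul]; linear_combination (C (w 1)) * h0 - (C (w 0)) * h1
    have e' : v 0 * w 1 = v 1 * w 0 := (C_injective _ _) e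
    obtain ⟨Xp, hXp⟩ := exists_scalar_of_cross (σ := Fin 3 → Fin (qOf m)) (fun k => C (v k)) w hw
      (by
        show C (v 0) * C (w 1) = C (v 1) * C (w 0)
        rw [← C_mul, ← C_mul, e'])
    exact ⟨Xp, fun k => by rw [col_nil]; exact hXp k⟩
  | cons L rest ih =>
    intro v w x hnd hdet hreg hw hx
    rw [List.map_cons, List.nodup_cons] at hnd
    have i₀ : Fin m := ⟨0, by omega⟩
    have hg : skelAt t rest v ≠ 0 := hreg rest (List.suffix_cons L rest) (by simp)
    have hreg' : ∀ s : List (W2Link m), s <:+ rest → s.length < rest.length → skelAt t s v ≠ 0 :=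
      fun s hs hlt => hreg s (hs.trans (List.suffix_cons L rest)) (by rw [List.length_cons]; omega)
    have H : ∀ k, Polynomial.aeval (kiPer m L.blk) (L.M k 0) * bind₁ (kiPer m) (col rest v 0) +
        Polynomial.aeval (kiPer m L.blk) (L.M k 1) * bind₁ (kiPer m) (col rest v 1) = x * C (w k) :=
      fun k => by rw [← bind₁_col_cons]; exact hx k
    obtain ⟨⟨x', hx'⟩, hb⟩ := step hm L.blk i₀ t L.M (hdet L List.mem_cons_self) w (skelAt t rest v) hg x
      (fun j => bind₁ (kiPer m) (col rest v j)) (fun j => transHom_bind₁_col hm hnd.1 i₀ t v j) H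
    obtain ⟨Xp', hXp'⟩ := ih v (skelAt t rest v) x' hnd.2 (fun L' hL' => hdet L' (List.mem_cons_of_mem _ hL'))
      hreg' hg hx'
    refine ⟨Xp' * uni L.blk (transHom m L.blk i₀ t x), fun k => ?_⟩
    have hbk := congrArg (uni L.blk) (hb k)
    rw [uni_add, uni_mul, uni_mul, uni_mul, uni_C, uni_C, uni_C] at hbk
    rw [col_cons, hXp' 0, hXp' 1]
    linear_combination Xp' * hbk

/-- **HITTING AT BASE POINT `t`** (`m ≥ 3`): nonsingular links and nonzero proper-suffix skeleton vectors at `t` give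
`φ(value) = 0 → value = 0`. [this file] -/
theorem chainVal_eq_zero_of_skelAt (hm : 3 ≤ m) (t : ℂ) (l : List (W2Link m)) (hl : (l.map W2Link.blk).Nodup)
    (hdet : ∀ L ∈ l, L.M.det ≠ 0) (u v : Fin 2 → ℂ)
    (hreg : ∀ s : List (W2Link m), s <:+ l → s.length < l.length → skelAt t s v ≠ 0)
    (h : bind₁ (kiPer m) (chainVal (l.map W2Link.mat) u v) = 0) : chainVal (l.map W2Link.mat) u v = 0 := by
  by_cases hu : u = 0
  · subst hu
    rw [chainVal_eq_col]
    simp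
  · have hw : (![u 1, -u 0] : Fin 2 → ℂ) ≠ 0 := fun h0 => hu (by
      funext i
      fin_cases i
      · simpa using congrFun h0 1
      · simpa using congrFun h0 0)
    rw [chainVal_eq_col, map_add, map_mul, map_mul, bind₁_C_right, bind₁_C_right] at h
    have hcross : (fun j => bind₁ (kiPer m) (col l v j)) 0 * C ((![u 1, -u 0] : Fin 2 → ℂ) 1) =
        (fun j => bind₁ (kiPer m) (col l v j)) 1 * C ((![u 1, -u 0] : Fin 2 → ℂ) 0) := by
      simp only [Matrix.cons_val_zero, Matrix.cons_val_one, map_neg]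
      linear_combination -h
    obtain ⟨x, hx⟩ := exists_scalar_of_cross (fun j => bind₁ (kiPer m) (col l v j)) ![u 1, -u 0] hw hcross
    obtain ⟨Xp, hXp⟩ := col_parallel hm t l v ![u 1, -u 0] x hl hdet hreg hw hx
    rw [chainVal_eq_col, hXp 0, hXp 1]
    simp only [Matrix.cons_val_zero, Matrix.cons_val_one, map_neg]
    ring

/-! ## 5. Every nonsingular width-2 read-once chain is hit -/
/-- **EVERY WIDTH-2 READ-ONCE CHAIN WITH NONSINGULAR LINKS IS HIT** (`m ≥ 3`; distinct blocks, any boundary vectors,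
order, length, degree, crowding; NO stall hypothesis): `det M_j ≢ 0` for every link and `value ≠ 0` ⟹ `φ(value) ≠ 0`.
It contains the ALREADY decided classes of `kiPer_hits_of_det_constMat_ne_zero` (`det M_j(0) ≠ 0`, e.g. continuant
chains) and of `DefinabilityGapAxisSubstitution` (triangular); NEWLY decided are the nonsingular chains whose constant
skeleton STALLS at `0`, e.g. links `[[z_c + 1, 1], [z_c, z_c]]` (`det = z_c²`, `M(0)` singular) on any crowded block set.
Non-vacuous: `m = 3`, one link `(c, [[1, X], [0, 1]])`, `u = e₀`, `v = e₁` has value `z_c ≠ 0`; a NEW-class instance is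
the one-link chain `(c, [[X + 1, 1], [X, X]])`, `u = v = e₁`, value `z_c ≠ 0` (`M(0) = [[1,1],[0,0]]` stalls at `0`).
Labels: helper on the width road of leaf 23704 · 0 S-currency · closes NO item · NOT a rung or leaf above RatioLeaf ·
KIPlantedHitting / DcPerSuperpolynomial / VP ≠ VNP untouched. [this file] -/
theorem kiPer_hits_widthTwo_of_det_ne_zero (hm : 3 ≤ m) (l : List (W2Link m)) (hl : (l.map W2Link.blk).Nodup)
    (hdet : ∀ L ∈ l, L.M.det ≠ 0) (u v : Fin 2 → ℂ) (hD : chainVal (l.map W2Link.mat) u v ≠ 0) :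
    bind₁ (kiPer m) (chainVal (l.map W2Link.mat) u v) ≠ 0 := by
  intro h
  by_cases hv : v = 0
  · subst hv
    rw [chainVal_eq_col, col_zero, col_zero, mul_zero, mul_zero, add_zero] at hD
    exact hD rfl
  obtain ⟨t, ht⟩ := exists_skelAt_ne_zero l hdet hv
  exact hD (chainVal_eq_zero_of_skelAt hm t l hl hdet u v (fun s hs _ => ht s hs) h)

end Summit.ValiantsHypothesis.ValiantsHypothesis.Theorems.DefinabilityGapTranslatedSkeleton
end
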